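import Literature.AnabelianGeometry.AbsoluteAnabelian.AbsTopIII.AutHolLogFrobeniusIncompatibility
import HarnessLib

/-!
# [AbsTopIII] Corollary 4.5 (iv), second incompatibility: DERIVED from the Lemma-4.4 obstruction

S. Mochizuki, *Topics in Absolute Anabelian Geometry III*, Cor. 4.5 (iv) pp. 108–110 (bib key
`MochizukiAbsTopIII2015`; lit key `paper:url-5493eb38cbb7`, kurims manuscript pages): "Finally, the
telecore structure `𝔗_LH` of (ii), the contact structure `ℋ_LH` of (ii), and the observable `𝔖_log`
of (iii) are not simultaneously compatible", proof p. 110: "applying the homotopy `η_{□⋎+1}` of the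
contact structure `ℋ_LH` yields a homotopy `[φ_□] ⇝ [id_{⋎+1}]∘[φ_{⋎+1}]`; on the other hand … a
homotopy `[φ_□] ⇝ [id_⋎]∘[φ_⋎] ⇝ [id_⋎]∘[β¹_⋎]∘[log]∘[φ_{⋎+1}] ⇝ [id_⋎]∘[log]∘[φ_{⋎+1}]` by applying
`η_{□⋎}`, the homotopies of the telecore `𝔗_LH`, and `η_⋎`" — an ISOMORPHISM in any common family
`K` for the pair `([id_{⋎+1}]∘[φ_{⋎+1}], [id_⋎]∘[log]∘[φ_{⋎+1}])` — "Thus … the argument applied in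
the proof of the first incompatibility of (iv) … a contradiction to Lemma 4.4".
This file (seat abc-iut-L4-t10, block W2-B4, node `AbsTopIII:Cor4.5(iv)`):
* `false_of_prefixed_core_compatible_of_obstruction` — the §4-direction core argument of
  `AutHolLogFrobeniusIncompatibility.lean` (`false_of_core_compatible_of_obstruction`) BEHIND A PREFIX
  EDGE `f : w → v₁` (the telecore edge `φ_{⋎+1}`), for any family of homotopies on any diagram
  (mirror image of abc-iut-L4-t5's `false_of_prefixed_core_compatible_of_obstruction_left`,
  `AbsTopIII/FrobeniusPictureMLFIncompatibility.lean`, §3 direction);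
* `telecoreIncompatibleStmt_of_lemma44` — t5's pinned `LogFrobeniusData.TelecoreIncompatibleStmt τ`
  DEDUCED, for data of Aut-holomorphic type (`Δ.ιtimes = inr ι`) with an object of `Anab`, from the
  Lemma-4.4 property (`Lemma44Property ι`); the construction of the isomorphism from the contact and
  telecore homotopies is the printed one (and, in Lean, the one of t5's
  `telecoreIncompatibleStmt_of_lemma34`, adapted);
* `cor_4_5_iv_of_lemma44` — BOTH sentences of Cor. 4.5 (iv) (`Cor_4_5_iv Δ τ` of
  `AutHolLogFrobenius.lean`) from the Lemma-4.4 property: (iv) is reduced to its one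
  model-dependent input.
Nothing here takes a side on inter-universal Teichmüller theory.
-/

namespace Literature.AnabelianGeometry.AbsoluteAnabelian.AbsTopIII

open _root_.CategoryTheory _root_.Quiver

universe u v' u' w' v₁ v₂ u₁ u₂

section Prefixed

/-- Components of a natural transformation at propositionally equal objects. [folklore] -/
private theorem app_eq_of_obj_eq₄ {C : Type u₁} [Category.{v₁} C] {C' : Type u₂} [Category.{v₂} C']
    {F G : C ⥤ C'} (θ : F ⟶ G) {X Y : C} (h : X = Y) :
    θ.app X = eqToHom (by rw [h]) ≫ θ.app Y ≫ eqToHom (by rw [h]) := by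
  subst h
  simp

/-- Conjugating an identity by `eqToHom` gives an identity. [folklore] -/
private theorem eqToHom_conj_eq_id₄ {C : Type u₁} [Category.{v₁} C] {X Y : C} (h : X = Y) {f : X ⟶ X}
    (hf : f = 𝟙 X) : eqToHom h.symm ≫ f ≫ eqToHom h = 𝟙 Y := by
  subst hf
  simp

/-- Merging the `eqToHom`s of a singly nested conjugate. [folklore] -/
private theorem eqToHom_sandwich₄ {C : Type u₁} [Category.{v₁} C] {A B₁ B₂ C₁ C₂ E : C} (p : A = B₁)
    (q : B₁ = B₂) (m : B₂ ⟶ C₁) (r : C₁ = C₂) (s : C₂ = E) :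
    eqToHom p ≫ (eqToHom q ≫ m ≫ eqToHom r) ≫ eqToHom s =
      eqToHom (p.trans q) ≫ m ≫ eqToHom (r.trans s) := by
  cases p; cases q; cases r; cases s; simp

/-- Merging the `eqToHom`s of a doubly nested conjugate. [folklore] -/
private theorem eqToHom_sandwich₄₂ {C : Type u₁} [Category.{v₁} C] {A B₁ B₂ B₃ C₁ C₂ C₃ E : C}
    (p : A = B₁) (q : B₁ = B₂) (q' : B₂ = B₃) (m : B₃ ⟶ C₁) (r : C₁ = C₂) (r' : C₂ = C₃) (s : C₃ = E) :
    eqToHom p ≫ (eqToHom q ≫ (eqToHom q' ≫ m ≫ eqToHom r) ≫ eqToHom r') ≫ eqToHom s =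
      eqToHom (p.trans (q.trans q')) ≫ m ≫ eqToHom (r.trans (r'.trans s)) := by
  cases p; cases q; cases q'; cases r; cases r'; cases s; simp

/-- Composing two `eqToHom`-conjugates whose middle `eqToHom`s cancel. [folklore] -/
private theorem eqToHom_sandwich_comp₄ {C : Type u₁} [Category.{v₁} C] {A X Y Y' Z W : C} (a : A = X)
    (f : X ⟶ Y) (b : Y = Y') (b' : Y' = Y) (g : Y ⟶ Z) (c : Z = W) :
    (eqToHom a ≫ f ≫ eqToHom b) ≫ (eqToHom b' ≫ g ≫ eqToHom c) =
      eqToHom a ≫ (f ≫ g) ≫ eqToHom c := by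
  cases a; cases b; cases c; simp

/-- **The core of the proof of Cor. 4.5 (iv) behind a prefix edge** (`f : w → v₁`; in Cor. 4.5 the
telecore edge `φ_{⋎+1} : LinHol → 𝒳`), for an arbitrary family of homotopies `K` on an arbitrary
diagram of categories: if `K` contains an ISOMORPHISM for the pair `([id₁]∘[f], [id₀]∘[log]∘[f])`
("two mutually contradictory homotopies", p. 110), the type-(4) pair `([λ^∼],[λ^×])` with components
`ι_×` and the type-(1) pair with components `ι_log`, then at `x₀ = f(a₀)` the composite
`λ^×(α) ≫ ι_log(x₀) ≫ ι_×(id₁ x₀)` is the identity for the isomorphism `α = ζ(a₀)` — so a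
component-level obstruction at `x₀` (Lemma 4.4) yields a contradiction.
[cite: MochizukiAbsTopIII2015, Corollary 4.5 (iv) p.110] -/
theorem false_of_prefixed_core_compatible_of_obstruction {V : Type w'} [Quiver.{v'} V]
    {D : DiagramOfCategories.{v', u', w'} V} (K : D.HomotopyFamily) {w v1 v0 sq ob : V}
    (f : w ⟶ v1) (eLog : v1 ⟶ v0) (eId1 : v1 ⟶ sq) (eId0 : v0 ⟶ sq) (eT eP : sq ⟶ ob)
    (ιt : D.map eP ⟶ D.map eT)
    (ιl : (D.map eLog ⋙ D.map eId0) ⋙ D.map eT ⟶ D.map eId1 ⋙ D.map eP)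
    (h₀ : K.E (((Path.nil : Path w w).cons f).cons eId1)
      ((((Path.nil : Path w w).cons f).cons eLog).cons eId0))
    (hiso : IsIso (K.η h₀))
    (hP : K.E ((Path.nil : Path sq sq).cons eP) ((Path.nil : Path sq sq).cons eT))
    (hhP : ∀ (x : D.obj sq)
      (e₁ : (D.pathFunctor ((Path.nil : Path sq sq).cons eP)).obj x = (D.map eP).obj x)
      (e₂ : (D.pathFunctor ((Path.nil : Path sq sq).cons eT)).obj x = (D.map eT).obj x),
      (K.η hP).app x = eqToHom e₁ ≫ ιt.app x ≫ eqToHom e₂.symm)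
    (h₁ : K.E ((((Path.nil : Path v1 v1).cons eLog).cons eId0).cons eT)
      (((Path.nil : Path v1 v1).cons eId1).cons eP))
    (hh₁ : ∀ (x : D.obj v1)
      (e₁ : (D.pathFunctor ((((Path.nil : Path v1 v1).cons eLog).cons eId0).cons eT)).obj x =
        (D.map eT).obj ((D.map eId0).obj ((D.map eLog).obj x)))
      (e₂ : (D.pathFunctor (((Path.nil : Path v1 v1).cons eId1).cons eP)).obj x =
        (D.map eP).obj ((D.map eId1).obj x)),
      (K.η h₁).app x = eqToHom e₁ ≫ ιl.app x ≫ eqToHom e₂.symm)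
    (a₀ : D.obj w)
    (obstruction : ∀ (a : (D.map eId1).obj ((D.map f).obj a₀) ⟶
        (D.map eId0).obj ((D.map eLog).obj ((D.map f).obj a₀))), IsIso a →
      (D.map eT).map a ≫ ιl.app ((D.map f).obj a₀) ≫ ιt.app ((D.map eId1).obj ((D.map f).obj a₀)) ≠
        𝟙 ((D.map eT).obj ((D.map eId1).obj ((D.map f).obj a₀)))) : False := by
  -- functor identifications along the explicit paths (equation lemmas of `pathFunctor`)
  have E0 : D.pathFunctor (Path.nil : Path w w) = 𝟭 _ := DiagramOfCategories.pathFunctor_nil _ _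
  have E0v : D.pathFunctor (Path.nil : Path v1 v1) = 𝟭 _ := DiagramOfCategories.pathFunctor_nil _ _
  have E0' : D.pathFunctor (Path.nil : Path ob ob) = 𝟭 _ := DiagramOfCategories.pathFunctor_nil _ _
  have ET : D.pathFunctor ((Path.nil : Path sq sq).cons eT) = D.map eT := by
    rw [DiagramOfCategories.pathFunctor_cons, DiagramOfCategories.pathFunctor_nil, Functor.id_comp]
  have EP : D.pathFunctor ((Path.nil : Path sq sq).cons eP) = D.map eP := by
    rw [DiagramOfCategories.pathFunctor_cons, DiagramOfCategories.pathFunctor_nil, Functor.id_comp]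
  have EF : D.pathFunctor ((Path.nil : Path w w).cons f) = D.map f := by
    rw [DiagramOfCategories.pathFunctor_cons, DiagramOfCategories.pathFunctor_nil, Functor.id_comp]
  have E1 : D.pathFunctor (((Path.nil : Path w w).cons f).cons eId1) = D.map f ⋙ D.map eId1 := by
    rw [DiagramOfCategories.pathFunctor_cons, EF]
  have E2 : D.pathFunctor ((((Path.nil : Path w w).cons f).cons eLog).cons eId0) =
      (D.map f ⋙ D.map eLog) ⋙ D.map eId0 := by
    rw [DiagramOfCategories.pathFunctor_cons, DiagramOfCategories.pathFunctor_cons, EF]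
  have E3 : D.pathFunctor ((((Path.nil : Path w w).cons f).cons eId1).cons eT) =
      (D.map f ⋙ D.map eId1) ⋙ D.map eT := by
    rw [DiagramOfCategories.pathFunctor_cons, E1]
  have E4 : D.pathFunctor ((((Path.nil : Path w w).cons f).cons eId1).cons eP) =
      (D.map f ⋙ D.map eId1) ⋙ D.map eP := by
    rw [DiagramOfCategories.pathFunctor_cons, E1]
  have E5 : D.pathFunctor (((((Path.nil : Path w w).cons f).cons eLog).cons eId0).cons eT) =
      ((D.map f ⋙ D.map eLog) ⋙ D.map eId0) ⋙ D.map eT := by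
    rw [DiagramOfCategories.pathFunctor_cons, E2]
  have U4 : D.pathFunctor (((Path.nil : Path v1 v1).cons eId1).cons eP) = D.map eId1 ⋙ D.map eP := by
    rw [DiagramOfCategories.pathFunctor_cons, DiagramOfCategories.pathFunctor_cons, E0v,
      Functor.id_comp]
  have U5 : D.pathFunctor ((((Path.nil : Path v1 v1).cons eLog).cons eId0).cons eT) =
      (D.map eLog ⋙ D.map eId0) ⋙ D.map eT := by
    rw [DiagramOfCategories.pathFunctor_cons, DiagramOfCategories.pathFunctor_cons,
      DiagramOfCategories.pathFunctor_cons, E0v, Functor.id_comp]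
  -- the three homotopies of the chain, all behind the prefix `f`
  have s1 : K.E (((((Path.nil : Path w w).cons f).cons eId1)).cons eT)
      (((((Path.nil : Path w w).cons f).cons eLog).cons eId0).cons eT) :=
    K.isSaturated.precomp (K.isSaturated.postcomp h₀ ((Path.nil : Path sq sq).cons eT)) Path.nil
  have h₁' : K.E (((((Path.nil : Path w w).cons f).cons eLog).cons eId0).cons eT)
      ((((Path.nil : Path w w).cons f).cons eId1).cons eP) :=
    K.isSaturated.precomp (K.isSaturated.postcomp h₁ Path.nil) ((Path.nil : Path w w).cons f)
  have s3 : K.E ((((Path.nil : Path w w).cons f).cons eId1).cons eP)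
      ((((Path.nil : Path w w).cons f).cons eId1).cons eT) :=
    K.isSaturated.precomp (K.isSaturated.postcomp hP Path.nil)
      (((Path.nil : Path w w).cons f).cons eId1)
  -- ζ'₁ = ζ₂ ∘ ζ₁ ∘ ζ'₀ is the homotopy of a pair `([γ],[γ])`, hence the identity
  have key : (K.η s1 ≫ K.η h₁') ≫ K.η s3 = 𝟙 _ := by
    rw [← K.η_trans s1 h₁', ← K.η_trans]
    exact K.η_refl _
  -- the whiskering axiom of Def. 3.5 (ii) (b)
  have W1 := K.η_whisker h₀ (Path.nil : Path w w) ((Path.nil : Path sq sq).cons eT)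
  have W2 := K.η_whisker h₁ ((Path.nil : Path w w).cons f) (Path.nil : Path ob ob)
  have W3 := K.η_whisker hP (((Path.nil : Path w w).cons f).cons eId1) (Path.nil : Path ob ob)
  -- object identifications at `a₀`
  have hx0 : (D.pathFunctor (Path.nil : Path w w)).obj a₀ = a₀ := Functor.congr_obj E0 a₀
  have hxf : (D.pathFunctor ((Path.nil : Path w w).cons f)).obj a₀ = (D.map f).obj a₀ :=
    Functor.congr_obj EF a₀
  have hx1 : (D.pathFunctor (((Path.nil : Path w w).cons f).cons eId1)).obj a₀ =
      (D.map eId1).obj ((D.map f).obj a₀) := Functor.congr_obj E1 a₀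
  have o2 : (D.pathFunctor ((((Path.nil : Path w w).cons f).cons eLog).cons eId0)).obj a₀ =
      (D.map eId0).obj ((D.map eLog).obj ((D.map f).obj a₀)) := Functor.congr_obj E2 a₀
  have o3 : (D.pathFunctor ((((Path.nil : Path w w).cons f).cons eId1).cons eT)).obj a₀ =
      (D.map eT).obj ((D.map eId1).obj ((D.map f).obj a₀)) := Functor.congr_obj E3 a₀
  have M₁ : (D.pathFunctor ((((Path.nil : Path w w).cons f).cons eId1).cons eT)).obj a₀ =
      (D.map eT).obj ((D.pathFunctor (((Path.nil : Path w w).cons f).cons eId1)).obj a₀) := by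
    rw [E3, E1]; rfl
  have M₂ : (D.map eT).obj
        ((D.pathFunctor ((((Path.nil : Path w w).cons f).cons eLog).cons eId0)).obj a₀) =
      (D.pathFunctor (((((Path.nil : Path w w).cons f).cons eLog).cons eId0).cons eT)).obj a₀ := by
    rw [E5, E2]; rfl
  have N₁ : (D.pathFunctor (((((Path.nil : Path w w).cons f).cons eLog).cons eId0).cons eT)).obj a₀ =
      (D.map eT).obj ((D.map eId0).obj ((D.map eLog).obj ((D.map f).obj a₀))) :=
    Functor.congr_obj E5 a₀
  have N₂ : (D.map eP).obj ((D.map eId1).obj ((D.map f).obj a₀)) =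
      (D.pathFunctor ((((Path.nil : Path w w).cons f).cons eId1).cons eP)).obj a₀ :=
    (Functor.congr_obj E4 a₀).symm
  have R₂ : (D.map eT).obj ((D.map eId1).obj ((D.map f).obj a₀)) =
      (D.pathFunctor ((((Path.nil : Path w w).cons f).cons eId1).cons eT)).obj a₀ := o3.symm
  -- ζ'₀ behind the prefix: λ^×(ζ(a₀))
  have W1x := NatTrans.congr_app W1 a₀
  simp only [NatTrans.comp_app, eqToHom_app, Functor.whiskerLeft_app, Functor.whiskerRight_app,
    Functor.congr_hom ET, app_eq_of_obj_eq₄ (K.η h₀) hx0, Functor.map_comp, eqToHom_map,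
    Category.assoc, eqToHom_trans, eqToHom_trans_assoc] at W1x
  have W1c : (K.η s1).app a₀ = eqToHom M₁ ≫ (D.map eT).map ((K.η h₀).app a₀) ≫ eqToHom M₂ :=
    W1x.trans (eqToHom_sandwich₄ _ _ _ _ _)
  -- ζ₁ behind the prefix: ι_log(f a₀)
  have W2x := NatTrans.congr_app W2 a₀
  simp only [NatTrans.comp_app, eqToHom_app, Functor.whiskerLeft_app, Functor.whiskerRight_app,
    Functor.congr_hom E0', Functor.id_map, app_eq_of_obj_eq₄ (K.η h₁) hxf,
    hh₁ ((D.map f).obj a₀) (Functor.congr_obj U5 _) (Functor.congr_obj U4 _),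
    Category.assoc, eqToHom_trans, eqToHom_trans_assoc] at W2x
  have W2c : (K.η h₁').app a₀ = eqToHom N₁ ≫
      (ιl.app ((D.map f).obj a₀) :
        (D.map eT).obj ((D.map eId0).obj ((D.map eLog).obj ((D.map f).obj a₀))) ⟶
          (D.map eP).obj ((D.map eId1).obj ((D.map f).obj a₀))) ≫ eqToHom N₂ :=
    W2x.trans (eqToHom_sandwich₄₂ _ _ _ _ _ _ _)
  -- ζ₂ behind the prefix: ι_×(id₁ (f a₀))
  have W3x := NatTrans.congr_app W3 a₀
  simp only [NatTrans.comp_app, eqToHom_app, Functor.whiskerLeft_app, Functor.whiskerRight_app,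
    Functor.congr_hom E0', Functor.id_map, app_eq_of_obj_eq₄ (K.η hP) hx1,
    hhP ((D.map eId1).obj ((D.map f).obj a₀)) (Functor.congr_obj EP _) (Functor.congr_obj ET _),
    Category.assoc, eqToHom_trans, eqToHom_trans_assoc] at W3x
  have W3c : (K.η s3).app a₀ =
      eqToHom N₂.symm ≫ ιt.app ((D.map eId1).obj ((D.map f).obj a₀)) ≫ eqToHom R₂ :=
    W3x.trans (eqToHom_sandwich₄₂ _ _ _ _ _ _ _)
  have keyx := NatTrans.congr_app key a₀
  simp only [NatTrans.comp_app, NatTrans.id_app, Category.assoc] at keyx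
  rw [W1c, W2c, W3c] at keyx
  -- `ζ₁` followed by `ζ₂`: the middle transports cancel
  have k3 : (eqToHom M₁ ≫ (D.map eT).map ((K.η h₀).app a₀) ≫ eqToHom M₂) ≫
      (eqToHom N₁ ≫ ((ιl.app ((D.map f).obj a₀) :
        (D.map eT).obj ((D.map eId0).obj ((D.map eLog).obj ((D.map f).obj a₀))) ⟶
          (D.map eP).obj ((D.map eId1).obj ((D.map f).obj a₀))) ≫
        ιt.app ((D.map eId1).obj ((D.map f).obj a₀))) ≫ eqToHom R₂) = 𝟙 _ :=
    (congrArg (fun t => (eqToHom M₁ ≫ (D.map eT).map ((K.η h₀).app a₀) ≫ eqToHom M₂) ≫ t)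
      (eqToHom_sandwich_comp₄ N₁
        (ιl.app ((D.map f).obj a₀) :
          (D.map eT).obj ((D.map eId0).obj ((D.map eLog).obj ((D.map f).obj a₀))) ⟶
            (D.map eP).obj ((D.map eId1).obj ((D.map f).obj a₀)))
        N₂ N₂.symm (ιt.app ((D.map eId1).obj ((D.map f).obj a₀))) R₂)).symm.trans keyx
  have keyx' := eqToHom_conj_eq_id₄ o3 k3
  simp only [Category.assoc, eqToHom_trans, eqToHom_trans_assoc, eqToHom_refl, Category.comp_id]
    at keyx'
  -- the isomorphism `α` and the obstruction
  haveI := hiso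
  refine obstruction (eqToHom hx1.symm ≫ (K.η h₀).app a₀ ≫ eqToHom o2) inferInstance ?_
  simp only [Functor.map_comp, eqToHom_map, Category.assoc]
  exact keyx'

end Prefixed

section Telecore

open LogFrobeniusData

variable {Δ : LogFrobeniusData.{u}}

/-- **Cor. 4.5 (iv), second incompatibility, from Lemma 4.4**: "the telecore structure `𝔗_LH`, the
contact structure `ℋ_LH`, and the observable `𝔖_log` are not simultaneously compatible", in the typed
form `LogFrobeniusData.TelecoreIncompatibleStmt τ`, for input data of Aut-holomorphic type
(`ι_× = ι : λ^∼ → λ^×`) with an object `a₀` of `Anab` and the Lemma-4.4 property.  Printed proof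
(p. 110 = p. 82 mutatis mutandis): in a common family `K` the contact homotopies `η_{□⋎+1}⁻¹`,
`η_{□⋎}`, the telecore homotopy of the loop `Anab → ⋎+1 → ⋎ → □ → 𝒩 → 𝒩' → Anab` and `η_⋎` compose
to an ISOMORPHISM for the pair `([id_{⋎+1}]∘[φ_{⋎+1}], [id_⋎]∘[log]∘[φ_{⋎+1}])`; then the argument of
the first incompatibility behind the prefix `φ_{⋎+1}`
(`false_of_prefixed_core_compatible_of_obstruction`) contradicts the Lemma-4.4 property at
`φ_{⋎+1}(a₀)`.  (The family-theoretic part is abc-iut-L4-t5's, `telecoreIncompatibleStmt_of_lemma34`.)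
[cite: MochizukiAbsTopIII2015, Corollary 4.5 (iv) p.110] -/
theorem telecoreIncompatibleStmt_of_lemma44 (τ : Δ.TelecoreData) (ι : Δ.lamPf ⟶ Δ.lamTimes)
    (hι : Δ.ιtimes = Sum.inr ι) (a₀ : Δ.A) (h44 : Lemma44Property ι) :
    Δ.TelecoreIncompatibleStmt τ := by
  intro H hH hc T hT
  rintro ⟨K, hJ, hC, htimes, hlog⟩
  -- telecore edges at `□`, `⋎ = 0 + 1`, `⋎ = 0`
  obtain ⟨jsq⟩ := (hT.edges_iff (vx 4 .nexus (by decide))).mpr (by decide)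
  obtain ⟨j1⟩ := (hT.edges_iff (vx 4 (.row1 (0 + 1)) (by simp [LFVertex.row]))).mpr
    (by simp [vx, LFVertex.row])
  obtain ⟨j0⟩ := (hT.edges_iff (vx 4 (.row1 0) (by simp [LFVertex.row]))).mpr
    (by simp [vx, LFVertex.row])
  -- the `𝔖_log` generators inside `K` (Aut-holomorphic orientation)
  rw [hι] at htimes
  obtain ⟨hPm, hhPm⟩ := htimes
  obtain ⟨h₁, hh₁⟩ := hlog 0
  -- the telecore loop `Anab → (⋎+1) → ⋎ → □ → 𝒩 → 𝒩' → Anab`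
  let loop : Path (tvObs T.J) (tvObs T.J) :=
    ((((((Path.nil : Path (tvObs T.J) (tvObs T.J)).cons (ePhi j1)).cons
      (show tvRow1 T.J (0 + 1) ⟶ tvRow1 T.J 0 from LFVertex.logEdge 0)).cons
      (show tvRow1 T.J 0 ⟶ tvNexus T.J from LFVertex.idEdge 0)).cons
      (show tvNexus T.J ⟶ tvThird T.J from LFVertex.lamTimesEdge)).cons
      (show tvThird T.J ⟶ tvFourth T.J from LFVertex.edge34)).cons
      (show tvFourth T.J ⟶ tvObs T.J from (PUnit.unit : coreI5.{u} (vx 4 .fourth (by decide))))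
  -- (1) `η_{□,⋎+1}⁻¹ : [id_{⋎+1}]∘[φ_{⋎+1}] ⇝ [φ_□]`, (2) `η_{□⋎} : [φ_□] ⇝ [id_⋎]∘[φ_⋎]`
  have c1 : K.E (pathPhiId (0 + 1) j1) (pathPhiNexus jsq) := hC _ _ (ContactGen.etaSqInv (0 + 1) jsq j1)
  have c2 : K.E (pathPhiNexus jsq) (pathPhiId 0 j0) := hC _ _ (ContactGen.etaSq 0 jsq j0)
  have c1' : K.E (pathPhiNexus jsq) (pathPhiId (0 + 1) j1) := hC _ _ (ContactGen.etaSq (0 + 1) jsq j1)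
  have c2' : K.E (pathPhiId 0 j0) (pathPhiNexus jsq) := hC _ _ (ContactGen.etaSqInv 0 jsq j0)
  -- (3) the telecore homotopy `[φ_⋎] ⇝ [φ_⋎]∘(loop)`, post-composed with `[id_⋎]`
  have t3 : T.Jfam.E ((Path.nil : Path (tvObs T.J) (tvObs T.J)).cons (ePhi j0)) (loop.cons (ePhi j0)) :=
    (T.boundary_iff _ _).mpr ⟨Path.nil, loop, (Path.nil : Path (tvObs T.J) (tvObs T.J)).cons (ePhi j0),
      rfl, rfl⟩
  have t3' : T.Jfam.E (loop.cons (ePhi j0)) ((Path.nil : Path (tvObs T.J) (tvObs T.J)).cons (ePhi j0)) :=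
    (T.boundary_iff _ _).mpr ⟨loop, Path.nil, (Path.nil : Path (tvObs T.J) (tvObs T.J)).cons (ePhi j0),
      rfl, rfl⟩
  have c3 : K.E (pathPhiId 0 j0)
      ((loop.cons (ePhi j0)).cons (show tvRow1 T.J 0 ⟶ tvNexus T.J from LFVertex.idEdge 0)) :=
    K.isSaturated.postcomp (hJ _ _ t3)
      ((Path.nil : Path (tvRow1 T.J 0) (tvRow1 T.J 0)).cons
        (show tvRow1 T.J 0 ⟶ tvNexus T.J from LFVertex.idEdge 0))
  have c3' : K.E ((loop.cons (ePhi j0)).cons (show tvRow1 T.J 0 ⟶ tvNexus T.J from LFVertex.idEdge 0))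
      (pathPhiId 0 j0) :=
    K.isSaturated.postcomp (hJ _ _ t3')
      ((Path.nil : Path (tvRow1 T.J 0) (tvRow1 T.J 0)).cons
        (show tvRow1 T.J 0 ⟶ tvNexus T.J from LFVertex.idEdge 0))
  -- (4) `η_⋎ : [β¹_⋎] ⇝ [β⁰_⋎]`, pre-composed with `[log]∘[φ_{⋎+1}]` and post-composed with `[id_⋎]`
  have c4 : K.E ((loop.cons (ePhi j0)).cons (show tvRow1 T.J 0 ⟶ tvNexus T.J from LFVertex.idEdge 0))
      ((((Path.nil : Path (tvObs T.J) (tvObs T.J)).cons (ePhi j1)).cons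
        (show tvRow1 T.J (0 + 1) ⟶ tvRow1 T.J 0 from LFVertex.logEdge 0)).cons
        (show tvRow1 T.J 0 ⟶ tvNexus T.J from LFVertex.idEdge 0)) :=
    K.isSaturated.precomp
      (K.isSaturated.postcomp (hC _ _ (ContactGen.etaRow1 0 j0))
        ((Path.nil : Path (tvRow1 T.J 0) (tvRow1 T.J 0)).cons
          (show tvRow1 T.J 0 ⟶ tvNexus T.J from LFVertex.idEdge 0)))
      (((Path.nil : Path (tvObs T.J) (tvObs T.J)).cons (ePhi j1)).cons
        (show tvRow1 T.J (0 + 1) ⟶ tvRow1 T.J 0 from LFVertex.logEdge 0))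
  have c4' : K.E ((((Path.nil : Path (tvObs T.J) (tvObs T.J)).cons (ePhi j1)).cons
        (show tvRow1 T.J (0 + 1) ⟶ tvRow1 T.J 0 from LFVertex.logEdge 0)).cons
        (show tvRow1 T.J 0 ⟶ tvNexus T.J from LFVertex.idEdge 0))
      ((loop.cons (ePhi j0)).cons (show tvRow1 T.J 0 ⟶ tvNexus T.J from LFVertex.idEdge 0)) :=
    K.isSaturated.precomp
      (K.isSaturated.postcomp (hC _ _ (ContactGen.etaRow1Inv 0 j0))
        ((Path.nil : Path (tvRow1 T.J 0) (tvRow1 T.J 0)).cons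
          (show tvRow1 T.J 0 ⟶ tvNexus T.J from LFVertex.idEdge 0)))
      (((Path.nil : Path (tvObs T.J) (tvObs T.J)).cons (ePhi j1)).cons
        (show tvRow1 T.J (0 + 1) ⟶ tvRow1 T.J 0 from LFVertex.logEdge 0))
  -- the isomorphism `[id_{⋎+1}]∘[φ_{⋎+1}] ⇝ [id_⋎]∘[log]∘[φ_{⋎+1}]` and its inverse
  have h₀ := K.isSaturated.trans (K.isSaturated.trans (K.isSaturated.trans c1 c2) c3) c4
  have h₀' := K.isSaturated.trans (K.isSaturated.trans (K.isSaturated.trans c4' c3') c2') c1'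
  have hiso : IsIso (K.η h₀) :=
    ⟨K.η h₀', by rw [← K.η_trans h₀ h₀', K.η_refl], by rw [← K.η_trans h₀' h₀, K.η_refl]⟩
  exact false_of_prefixed_core_compatible_of_obstruction K
    (w := tvObs T.J) (v1 := tvRow1 T.J (0 + 1)) (v0 := tvRow1 T.J 0) (sq := tvNexus T.J)
    (ob := tvThird T.J) (ePhi j1) (LFVertex.logEdge 0) (LFVertex.idEdge (0 + 1)) (LFVertex.idEdge 0)
    LFVertex.lamTimesEdge LFVertex.lamPfEdge ι Δ.ιlog h₀ hiso hPm hhPm h₁ hh₁ a₀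
    (fun a ha => h44 _ a ha)

/-- **Cor. 4.5 (iv) from Lemma 4.4**: both incompatibilities (`Cor_4_5_iv Δ τ`) for input data of
Aut-holomorphic type with an object `a₀` of `Anab = LinHol`, from the Lemma-4.4 property of the data —
Cor. 4.5 (iv) is reduced to its one model-dependent input (Lemma 4.4 p. 107 for the data of
Def. 4.1). [cite: MochizukiAbsTopIII2015, Corollary 4.5 (iv) p.110] -/
theorem cor_4_5_iv_of_lemma44 (τ : Δ.TelecoreData) (ι : Δ.lamPf ⟶ Δ.lamTimes)
    (hι : Δ.ιtimes = Sum.inr ι) (a₀ : Δ.A) (h44 : Lemma44Property ι) : Cor_4_5_iv Δ τ :=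
  ⟨incompatibleStmt_of_lemma44 ι hι (τ.φ₁.obj a₀) h44, telecoreIncompatibleStmt_of_lemma44 τ ι hι a₀ h44⟩

end Telecore

end Literature.AnabelianGeometry.AbsoluteAnabelian.AbsTopIII
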